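import Summits.Ventures.Crystal3D.Theorems.StickyWulffConstantTextureBuildSlabSealingLocal
import Summits.Ventures.Crystal3D.Theorems.StickyWulffConstantTextureBuildSlabPlates
import Summits.Ventures.Crystal3D.Theorems.StickyWulffConstantTextureLiminfCubeRigidityLocalStacking
import HarnessLib

/-!
# TB-1 brick (COL): a CERTIFIED COLUMN IS CLEAN — no vacant site and no off-lattice ball of the near-wall presentation inside the certified cylinder
# (lane T, crux `TextureLiminfV5`, stmt-Ventures-23912; memo HOME/wulff-p2/g25/SLAB-PLATES-g25.md §3 (COL), §6 (5))

HONEST FRAMING. Venture `Summits/Ventures/Crystal3D` (cell `crystal3d-full`), route `route-Ventures-StickyWulffConstant`, helper `--supports` the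
law-v5 crux `TextureLiminfV5` (stmt-Ventures-23912).  Bookkeeping (census-free, standard axioms) over '…TextureBuildSlabSealingLocal'.  No cover is built;
F-C1 not moved.

WHY.  The plate step ('…HealCollar' + '…SlabPlates') pays `6` per DEFECT of the grain presentation `S` in the collar of the chosen slab, and the pigeonhole makes
the total small as soon as the cell column holds few `S`-defects — (COL).  The descent ('…LayerDescentFrame' `descentPropagation`) delivers, in the witness-free
case, «every site of `S = stacking L b s` at the levels `0 … K+1` below `b` with ℓ¹-index `≤ N M` is a ball».  This file turns that into «the column is CLEAN»:

* `index_le_of_lateral` — a site `barlowPos 1 √(2/3) s k i j` (Hägg `s`) with both lateral frame coordinates `≤ ρ` in absolute value has `|i| + |j| ≤ 4ρ + |k|`;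
* **`column_clean`** — from the descent's conclusion with radii `N M ≥ 4ρ + K + 1`: (a) every BALL whose frame coordinates `v = L⁻¹(x c − b)` satisfy
  `−(K+1)√(2/3) ≤ v₃ ≤ 0` and `v₁² + v₂² ≤ (ρ − 1)²` lies on `S` (local slab sealing); (b) every SITE of `S` with `−(K+1)√(2/3) ≤ v₃ ≤ 0` and `v₁² + v₂² ≤ ρ²`
  is a ball.  Hence the defect set `Dfx` of `exists_slab_window` meets that cylinder in NOTHING, and (COL) only counts the material outside certified columns.
-/

noncomputable section

namespace Summit.Ventures.Crystal3D.Theorems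

open Literature.MathematicalPhysics.StatisticalMechanics
open Summit.Ventures.Crystal3D.Cruxes.TextureLiminf.TexShadow (stacking)
open Summit.Ventures.Crystal3D.Theorems.LocalStacking (abs_haggLabel_le)

/-! ## From lateral frame coordinates to the ℓ¹-index -/

/-- `|a| ≤ ρ` from `a² + c² ≤ ρ²`, `ρ ≥ 0`. -/
theorem abs_le_of_sq_add_sq_le {a c ρ : ℝ} (h : a ^ 2 + c ^ 2 ≤ ρ ^ 2) (hρ : 0 ≤ ρ) : |a| ≤ ρ :=
  abs_le_of_sq_le_sq (by nlinarith [sq_nonneg c]) hρ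

/-- **Index bound.**  A site of the ideal stacking of a Hägg word whose two lateral coordinates are at most `ρ` in absolute value has ℓ¹-index
`|i| + |j| ≤ 4ρ + |k|`. -/
theorem index_le_of_lateral {s : ℤ → ℤ} (hs : IsHaggSeq s) (k i j : ℤ) {ρ : ℝ}
    (h0 : |barlowPos 1 (Real.sqrt (2 / 3)) s k i j 0| ≤ ρ) (h1 : |barlowPos 1 (Real.sqrt (2 / 3)) s k i j 1| ≤ ρ) :
    ((|i| + |j| : ℤ) : ℝ) ≤ 4 * ρ + |(k : ℝ)| := by
  rw [barlowPos_apply_zero] at h0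
  rw [barlowPos_apply_one] at h1
  set Lk : ℝ := (haggLabel s k : ℝ) with hLk
  have hL : |Lk| ≤ |(k : ℝ)| := by rw [hLk]; exact_mod_cast abs_haggLabel_le hs k
  have hρ0 : 0 ≤ ρ := le_trans (abs_nonneg _) h0
  -- the two lateral forms
  have ht₁ : |(i : ℝ) + j / 2 + Lk / 2| ≤ ρ := by simpa using h0
  have h3 : (1 : ℝ) ≤ Real.sqrt 3 := by
    rw [show (1 : ℝ) = Real.sqrt 1 by simp]
    exact Real.sqrt_le_sqrt (by norm_num)
  have ht₂ : |(j : ℝ) + Lk / 3| ≤ 2 * ρ := by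
    have e : (1 : ℝ) * Real.sqrt 3 / 2 * (j + Lk / 3) = (Real.sqrt 3 / 2) * (j + Lk / 3) := by ring
    rw [e, abs_mul, abs_of_pos (by positivity)] at h1
    have hpos : 0 ≤ |(j : ℝ) + Lk / 3| := abs_nonneg _
    nlinarith
  -- `|j| ≤ |j + L/3| + |L|/3`, `|i| ≤ |t₁| + |j|/2 + |L|/2`
  have hj : |(j : ℝ)| ≤ |(j : ℝ) + Lk / 3| + |Lk| / 3 := by
    have := abs_sub ((j : ℝ) + Lk / 3) (Lk / 3)
    rw [add_sub_cancel_right, abs_div, abs_of_pos (by norm_num : (0 : ℝ) < 3)] at this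
    exact this
  have hi : |(i : ℝ)| ≤ |(i : ℝ) + j / 2 + Lk / 2| + |(j : ℝ)| / 2 + |Lk| / 2 := by
    have h := abs_sub ((i : ℝ) + j / 2 + Lk / 2) ((j : ℝ) / 2 + Lk / 2)
    rw [show (i : ℝ) + j / 2 + Lk / 2 - (j / 2 + Lk / 2) = i by ring] at h
    have h' := abs_add_le ((j : ℝ) / 2) (Lk / 2)
    rw [abs_div, abs_div, abs_of_pos (by norm_num : (0 : ℝ) < 2)] at h'
    linarith
  have hcast : ((|i| + |j| : ℤ) : ℝ) = |(i : ℝ)| + |(j : ℝ)| := by push_cast; rfl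
  rw [hcast]
  linarith

/-! ## The clean column -/

section Column

variable {N₀ : ℕ} {x : Fin N₀ → EuclideanSpace ℝ (Fin 3)}

/-- The frame point on the axis at the height of `v`. -/
theorem dist_axisPoint_eq (v : EuclideanSpace ℝ (Fin 3)) :
    dist v (WithLp.toLp 2 ![0, 0, v 2] : EuclideanSpace ℝ (Fin 3)) = Real.sqrt (v 0 ^ 2 + v 1 ^ 2) := by
  rw [EuclideanSpace.dist_eq, Fin.sum_univ_three]
  congr 1
  simp

/-- **A CERTIFIED COLUMN IS CLEAN.**  See the module docstring. -/
theorem column_clean (hx : IsUnitPacking x) {s : ℤ → ℤ} (hs : IsHaggSeq s)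
    (L : EuclideanSpace ℝ (Fin 3) ≃ₗᵢ[ℝ] EuclideanSpace ℝ (Fin 3)) (b : EuclideanSpace ℝ (Fin 3)) (K : ℕ) (N : ℕ → ℤ) {ρ : ℝ} (hρ : 1 ≤ ρ)
    (hN : ∀ M : ℕ, M ≤ K + 1 → 4 * ρ + ((K : ℝ) + 1) ≤ ((N M : ℤ) : ℝ))
    (hocc : ∀ M : ℕ, M ≤ K + 1 → ∀ i j : ℤ, |i| + |j| ≤ N M →
      L (barlowPos 1 (Real.sqrt (2 / 3)) s (-(M : ℤ)) i j) + b ∈ Set.range x) :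
    (∀ c : Fin N₀, -(((K : ℝ) + 1) * Real.sqrt (2 / 3)) ≤ (L.symm (x c - b)) 2 → (L.symm (x c - b)) 2 ≤ 0 →
        (L.symm (x c - b)) 0 ^ 2 + (L.symm (x c - b)) 1 ^ 2 ≤ (ρ - 1) ^ 2 → x c ∈ stacking L b s) ∧
    (∀ w ∈ stacking L b s, -(((K : ℝ) + 1) * Real.sqrt (2 / 3)) ≤ (L.symm (w - b)) 2 → (L.symm (w - b)) 2 ≤ 0 →
        (L.symm (w - b)) 0 ^ 2 + (L.symm (w - b)) 1 ^ 2 ≤ ρ ^ 2 → w ∈ Set.range x) := by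
  have hsq : Real.sqrt (2 / 3) ^ 2 = 2 / 3 := Real.sq_sqrt (by norm_num)
  have hpos : 0 < Real.sqrt (2 / 3) := by positivity
  have hρ0 : 0 ≤ ρ := by linarith
  -- a site of a level `k' ∈ [−(K+1), 0]` with lateral coordinates `≤ ρ` is a ball
  have site_ball : ∀ k' i j : ℤ, -((K : ℤ) + 1) ≤ k' → k' ≤ 0 →
      |barlowPos 1 (Real.sqrt (2 / 3)) s k' i j 0| ≤ ρ → |barlowPos 1 (Real.sqrt (2 / 3)) s k' i j 1| ≤ ρ →
      L (barlowPos 1 (Real.sqrt (2 / 3)) s k' i j) + b ∈ Set.range x := by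
    intro k' i j hk1 hk2 h0 h1
    obtain ⟨M, hM⟩ : ∃ M : ℕ, k' = -(M : ℤ) := ⟨(-k').toNat, by omega⟩
    have hMK : M ≤ K + 1 := by omega
    have hidx := index_le_of_lateral hs k' i j h0 h1
    have hk' : |(k' : ℝ)| ≤ (K : ℝ) + 1 := by
      rw [abs_le]; constructor <;> [exact_mod_cast (by omega : -((K : ℤ) + 1) ≤ k'); exact_mod_cast (by omega : k' ≤ (K : ℤ) + 1)]
    have hle : ((|i| + |j| : ℤ) : ℝ) ≤ ((N M : ℤ) : ℝ) := by linarith [hN M hMK]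
    have hle' : |i| + |j| ≤ N M := by exact_mod_cast hle
    rw [hM]
    exact hocc M hMK i j hle'
  refine ⟨fun c hlo hhi hrad => ?_, fun w hw hlo hhi hrad => ?_⟩
  · -- (a) balls are sites: local slab sealing around the axis point at the ball's height
    set v := L.symm (x c - b) with hv
    set p₀ : EuclideanSpace ℝ (Fin 3) := WithLp.toLp 2 ![0, 0, v 2] with hp₀
    have hp₀0 : p₀ 0 = 0 := by simp [hp₀]
    have hp₀1 : p₀ 1 = 0 := by simp [hp₀]
    have hkm : (-((K : ℤ) + 1)) ≤ (0 : ℤ) := by omega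
    have hcomplete : ∀ k' i j : ℤ, -((K : ℤ) + 1) ≤ k' → k' ≤ 0 →
        dist (barlowPos 1 (Real.sqrt (2 / 3)) s k' i j) p₀ ≤ ρ → L (barlowPos 1 (Real.sqrt (2 / 3)) s k' i j) + b ∈ Set.range x := by
      intro k' i j hk1 hk2 hd
      have h0 := abs_sub_coord_le_dist (barlowPos 1 (Real.sqrt (2 / 3)) s k' i j) p₀ 0
      have h1 := abs_sub_coord_le_dist (barlowPos 1 (Real.sqrt (2 / 3)) s k' i j) p₀ 1
      rw [hp₀0, sub_zero] at h0
      rw [hp₀1, sub_zero] at h1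
      exact site_ball k' i j hk1 hk2 (h0.trans hd) (h1.trans hd)
    have hk : (-((K : ℤ) + 1) : ℤ) * Real.sqrt (2 / 3) ≤ v 2 := by push_cast; linarith
    have hm : v 2 ≤ (0 : ℤ) * Real.sqrt (2 / 3) := by push_cast; linarith
    have hdist : dist v p₀ ≤ ρ - 1 := by
      rw [hp₀, dist_axisPoint_eq]
      calc Real.sqrt (v 0 ^ 2 + v 1 ^ 2) ≤ Real.sqrt ((ρ - 1) ^ 2) := Real.sqrt_le_sqrt hrad
        _ = ρ - 1 := Real.sqrt_sq (by linarith)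
    exact (eq_site_of_stacking_complete_local hx s L b hkm p₀ ρ hcomplete c hk hm hdist).2
  · -- (b) sites are balls
    obtain ⟨p, ⟨k', i, j, rfl⟩, rfl⟩ := hw
    have hv : L.symm (L (barlowPos 1 (Real.sqrt (2 / 3)) s k' i j) + b - b) = barlowPos 1 (Real.sqrt (2 / 3)) s k' i j := by
      rw [add_sub_cancel_right, LinearIsometryEquiv.symm_apply_apply]
    rw [hv] at hlo hhi hrad
    rw [barlowPos_apply_two] at hlo hhi
    have hk1 : -((K : ℤ) + 1) ≤ k' := by
      have : (-((K : ℝ) + 1)) * Real.sqrt (2 / 3) ≤ (k' : ℝ) * Real.sqrt (2 / 3) := by linarith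
      have h' := le_of_mul_le_mul_right this hpos
      exact_mod_cast h'
    have hk2 : k' ≤ 0 := by
      have h' : (k' : ℝ) ≤ 0 := by nlinarith
      exact_mod_cast h'
    exact site_ball k' i j hk1 hk2 (abs_le_of_sq_add_sq_le hrad hρ0)
      (abs_le_of_sq_add_sq_le (by linarith [sq_nonneg (barlowPos 1 (Real.sqrt (2 / 3)) s k' i j 0)] :
        barlowPos 1 (Real.sqrt (2 / 3)) s k' i j 1 ^ 2 + barlowPos 1 (Real.sqrt (2 / 3)) s k' i j 0 ^ 2 ≤ ρ ^ 2) hρ0)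

end Column

end Summit.Ventures.Crystal3D.Theorems

end
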